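import Mathlib
import Literature.NumberTheory.LFunctions.CertifiedLFunctionUpsampling
import HarnessLib

/-!
# The DFT pair behind Platt's FFT evaluation of `L`-functions: Poisson summation with period `B`
# (Platt, Math. Comp. 85 (2016), §3, Theorem 3.2) — PROVED

Topic `Literature/NumberTheory/LFunctions`; namespace `Literature.NumberTheory.LFunctions`, engine
in the grouping namespace `Literature.NumberTheory.LFunctions.PoissonDFT`. Companion of
`CertifiedLFunctionUpsampling.lean` (§8 of the same paper: Whittaker–Shannon and Weiss, proved) and
of `DirichletLRiemannHypothesisUpTo.lean` (`platt2016_theorem71/72`, the certified numerics these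
sections underwrite). Source: D. J. Platt, *Numerical computations concerning the GRH*, Math. Comp.
**85** (2016) 3009–3027 [Platt2016GRH], §3 "The Discrete Fourier Transform", Definition 3.1 and
Theorem 3.2, pp. 3011–3012 (journal pdf `paper:url-20e4f76cdba6` pp. 3–4; = arXiv:1305.3087v1 §2,
Theorem 2.2). Platt: "To make the transition from the discrete to the continuous, we use the
following theorem."

**Theorem 3.2** (p. 3011, quoted). "Let `f` be a function in the Schwartz space with Fourier
transform `f̂` and `N = AB` with `A, B > 0`. Define `f̃(n) := Σ_{l ∈ ℤ} f(n/A + lB)` and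
`\tilde{f̂}(m) := Σ_{l ∈ ℤ} f̂(2πm/B + 2πlA)`. Then, up to a constant factor, `f̃(n)` and
`\tilde{f̂}(m)` form a DFT pair of length `N`." Proof (p. 3012): "By Poisson summation we have
`Σ_l f(t + lB) = (2π/B) Σ_l f̂(2πl/B) e(lt/B)` [...] We now write `l = l′N + m` to get
`f̃(n) = (2π/B) Σ_{m=0}^{N−1} e(mn/N) \tilde{f̂}(m)`. This is by definition an iDFT." Here
`f̂(x) = (1/2π)∫ f(t) e^{−itx} dt` (p. 3011) and `e(x) = exp(2πix)`; the DFT of Definition 3.1 is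
un-normalised, `Y_m = Σ_{n<N} X_n e(−nm/N)`, the iDFT has the opposite sign.

## What is typed (all PROVED from Mathlib; no named facts)

* `PoissonDFT.fourier_comp_affine` — `𝓕[x ↦ f(Bx + c)](ξ) = B⁻¹ e^{2πicξ/B} 𝓕 f(ξ/B)` (`B > 0`;
  Mathlib's `𝓕 f(ξ) = ∫ f(t)e^{−2πiξt} dt`).
* `PoissonDFT.tsum_translate_eq` — Poisson summation with period `B` and shift `c` for Schwartz `f`:
  `Σ_l f(c + lB) = B⁻¹ Σ_k e^{2πikc/B} 𝓕 f(k/B)` (the first display of the proof, from Mathlib's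
  `SchwartzMap.tsum_eq_tsum_fourier` applied to the Schwartz function `x ↦ f(Bx + c)`,
  `SchwartzMap.compCLMOfAntilipschitz`), with `PoissonDFT.summable_cexp_mul_fourier_div`.
* `PoissonDFT.tsum_int_eq_sum_tsum_mod` — "write `l = l′N + m`": `Σ_{k ∈ ℤ} h(k) =
  Σ_{r<N} Σ_{q ∈ ℤ} h(qN + r)` for summable `h` (`Int.divModEquiv`).
* `platt2016_poissonDFTPair` — **Theorem 3.2 over Mathlib's `𝓕`**: for `f` Schwartz, `A, B > 0`,
  `AB = N ≥ 1`, every `n ∈ ℤ`: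
  `Σ_l f(n/A + lB) = B⁻¹ Σ_{m<N} e(mn/N) Σ_l 𝓕 f((m + lN)/B)`.
* `platt2016_poissonDFTPair_printed` — **Theorem 3.2 AS PRINTED**: with Platt's `f̂` written out as
  `(1/2π)∫ f(t)e^{−itx} dt` (cf. `Upsampling.plattFourier_eq`),
  `f̃(n) = (2π/B) Σ_{m=0}^{N−1} e(mn/N) Σ_l f̂(2πm/B + 2πlA)`.

Design notes: the theorem is named `poissonDFTPair`, not `theorem32`, because the tree's
`platt2016_theorem32_corrected` refers to the arXiv numbering (arXiv Thm. 3.2 = journal Thm. 5.2,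
the zero-counting identity). Deliberately NOT here: Definition 3.1 as a `def` (Mathlib has
`ZMod.dft`; the identity is stated with the explicit finite sum), Bluestein's FFT and the
complexity remarks, Lemma 6.1 and §§6–7 (the algorithms that consume the DFT pair).

## References

* [Platt2016GRH] D. J. Platt, *Numerical computations concerning the GRH*, Math. Comp. 85 (2016),
  no. 302, 3009–3027: §3 Definition 3.1, Theorem 3.2, pp. 3011–3012.
-/

noncomputable section

open Complex Set MeasureTheory Filter
open scoped Real FourierTransform Topology SchwartzMap

namespace Literature.NumberTheory.LFunctions

namespace PoissonDFT

/-- The affine map `x ↦ Bx + c` has temperate growth. [folklore] -/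
private theorem hasTemperateGrowth_affine (B c : ℝ) :
    Function.HasTemperateGrowth (fun x : ℝ => B * x + c) := by
  have h1 : Function.HasTemperateGrowth (fun x : ℝ => B * x) :=
    (ContinuousLinearMap.mul ℝ ℝ B).hasTemperateGrowth
  exact h1.add (Function.HasTemperateGrowth.const c)

/-- The affine map `x ↦ Bx + c`, `B > 0`, is antilipschitz with constant `B⁻¹`. [folklore] -/
private theorem antilipschitz_affine {B : ℝ} (hB : 0 < B) (c : ℝ) :
    AntilipschitzWith (Real.toNNReal B⁻¹) (fun x : ℝ => B * x + c) := by
  refine AntilipschitzWith.of_le_mul_dist fun x y => ?_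
  rw [Real.dist_eq, Real.dist_eq, Real.coe_toNNReal _ (by positivity),
    show B * x + c - (B * y + c) = B * (x - y) by ring, abs_mul, abs_of_pos hB, ← mul_assoc,
    inv_mul_cancel₀ hB.ne', one_mul]

/-- **Fourier transform of an affine reparametrisation**: for `B > 0`,
`𝓕[x ↦ f(Bx + c)](ξ) = B⁻¹ e^{2πi c ξ/B} 𝓕 f (ξ/B)` (the substitution behind Poisson summation
with period `B`).
[cite: Platt2016GRH, Theorem 3.2 p. 3012 (proof: Poisson summation with period B)] -/
theorem fourier_comp_affine (f : ℝ → ℂ) {B : ℝ} (hB : 0 < B) (c ξ : ℝ) :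
    𝓕 (fun x : ℝ => f (B * x + c)) ξ
      = (B⁻¹ : ℂ) * cexp (2 * π * I * c * ξ / B) * 𝓕 f (ξ / B) := by
  rw [Real.fourier_real_eq_integral_exp_smul, Real.fourier_real_eq_integral_exp_smul]
  -- substitute `u = Bx + c`
  set Φ : ℝ → ℂ := fun u => cexp (↑(-2 * π * ((u - c) / B) * ξ) * I) • f u with hΦ
  have h1 : (fun v : ℝ => cexp (↑(-2 * π * v * ξ) * I) • f (B * v + c))
      = fun v : ℝ => (fun w : ℝ => Φ (w + c)) (B * v) := by
    funext v
    simp only [hΦ]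
    rw [show (B * v + c - c) / B = v by rw [add_sub_cancel_right]; field_simp]
  rw [h1, Measure.integral_comp_mul_left (fun w : ℝ => Φ (w + c)) B,
    integral_add_right_eq_self Φ c, abs_of_pos (inv_pos.mpr hB), hΦ]
  simp only [smul_eq_mul, Complex.real_smul]
  push_cast
  rw [mul_assoc]
  congr 1
  rw [← integral_const_mul]
  congr 1
  funext u
  rw [← mul_assoc, ← Complex.exp_add]
  congr 2
  have hB' : (B : ℂ) ≠ 0 := by exact_mod_cast hB.ne'
  field_simp
  ring

/-- The Fourier transform of the Schwartz function `x ↦ f(Bx + c)` at an integer, unfolded.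
[folklore] -/
private theorem fourier_affineComp_apply (f : 𝓢(ℝ, ℂ)) {B : ℝ} (hB : 0 < B) (c : ℝ) (k : ℤ) :
    𝓕 (SchwartzMap.compCLMOfAntilipschitz ℂ (hasTemperateGrowth_affine B c)
        (antilipschitz_affine hB c) f) k
      = (B⁻¹ : ℂ) * cexp (2 * π * I * c * k / B) * 𝓕 (f : ℝ → ℂ) (k / B) := by
  have e := congrFun (SchwartzMap.fourier_coe (SchwartzMap.compCLMOfAntilipschitz ℂ
    (hasTemperateGrowth_affine B c) (antilipschitz_affine hB c) f)) k
  rw [e]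
  exact fourier_comp_affine (f : ℝ → ℂ) hB c k

/-- Summability of `k ↦ e^{2πick/B} 𝓕 f(k/B)` over `ℤ` for Schwartz `f` (it is, up to `B⁻¹`, the
Fourier transform of the Schwartz function `x ↦ f(Bx + c)` sampled at the integers).
[cite: Platt2016GRH, Theorem 3.2 p. 3012 (proof: Poisson summation with period B)] -/
theorem summable_cexp_mul_fourier_div (f : 𝓢(ℝ, ℂ)) {B : ℝ} (hB : 0 < B) (c : ℝ) :
    Summable (fun k : ℤ => cexp (2 * π * I * c * k / B) * 𝓕 (f : ℝ → ℂ) (k / B)) := by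
  have h1 : Summable (fun k : ℤ => 𝓕 (SchwartzMap.compCLMOfAntilipschitz ℂ
      (hasTemperateGrowth_affine B c) (antilipschitz_affine hB c) f) k) :=
    summable_of_isBigO (Real.summable_abs_int_rpow one_lt_two)
      (((𝓕 (SchwartzMap.compCLMOfAntilipschitz ℂ (hasTemperateGrowth_affine B c)
      (antilipschitz_affine hB c) f)).isBigO_cocompact_rpow (-2)).comp_tendsto
        Int.tendsto_coe_cofinite)
  have e := fun k : ℤ => fourier_affineComp_apply f hB c k
  simp_rw [e, mul_assoc] at h1
  have h2 := h1.mul_left (B : ℂ)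
  simp_rw [← mul_assoc, mul_inv_cancel₀ (show (B : ℂ) ≠ 0 by exact_mod_cast hB.ne'), one_mul] at h2
  exact h2

/-- **Poisson summation with period `B` and shift `c`** (Platt's first display in the proof of
Theorem 3.2, in Mathlib's normalisation): for Schwartz `f` and `B > 0`,
`Σ_{l ∈ ℤ} f(c + lB) = B⁻¹ Σ_{k ∈ ℤ} e^{2πikc/B} 𝓕 f(k/B)`.
[cite: Platt2016GRH, Theorem 3.2 p. 3012 (proof, first display)] -/
theorem tsum_translate_eq (f : 𝓢(ℝ, ℂ)) {B : ℝ} (hB : 0 < B) (c : ℝ) :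
    ∑' l : ℤ, f (c + l * B)
      = (B⁻¹ : ℂ) * ∑' k : ℤ, cexp (2 * π * I * c * k / B) * 𝓕 (f : ℝ → ℂ) (k / B) := by
  have h := SchwartzMap.tsum_eq_tsum_fourier (SchwartzMap.compCLMOfAntilipschitz ℂ
      (hasTemperateGrowth_affine B c) (antilipschitz_affine hB c) f) 0
  simp only [zero_add, QuotientAddGroup.mk_zero, fourier_eval_zero, mul_one] at h
  have lhs : (fun l : ℤ => f (c + l * B)) = fun l : ℤ =>
      (SchwartzMap.compCLMOfAntilipschitz ℂ (hasTemperateGrowth_affine B c)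
      (antilipschitz_affine hB c) f) l := by
    funext l
    rw [SchwartzMap.compCLMOfAntilipschitz_apply, Function.comp_apply]
    ring_nf
  rw [lhs, h]
  have e := fun k : ℤ => fourier_affineComp_apply f hB c k
  simp_rw [e, mul_assoc]
  exact tsum_mul_left

/-- Regrouping a summable series over `ℤ` by residues modulo `N`:
`Σ_k h(k) = Σ_{r < N} Σ_q h(qN + r)` ("We now write `l = l′N + m`").
[cite: Platt2016GRH, Theorem 3.2 p. 3012 (proof, second display)] -/
theorem tsum_int_eq_sum_tsum_mod (h : ℤ → ℂ) (hs : Summable h) (N : ℕ) [NeZero N] :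
    ∑' k : ℤ, h k = ∑ r : Fin N, ∑' q : ℤ, h (q * N + r) := by
  set e : Fin N × ℤ ≃ ℤ := (Equiv.prodComm (Fin N) ℤ).trans (Int.divModEquiv N).symm with he
  have he' : ∀ p : Fin N × ℤ, e p = p.2 * N + p.1 := by
    intro p
    simp [he, Int.divModEquiv]
  rw [← e.tsum_eq]
  rw [Summable.tsum_prod' (f := fun p : Fin N × ℤ => h (e p)) (e.summable_iff.mpr hs) ?_,
    tsum_fintype]
  · simp_rw [he']
  · intro r
    refine (hs.comp_injective (i := fun q : ℤ => e (r, q)) fun q q' hq => ?_)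
    simpa [he', NeZero.ne N] using hq

/-- **Platt 2016, Theorem 3.2 (the DFT pair), over Mathlib's Fourier transform.** For a Schwartz
function `f`, `A, B > 0` with `AB = N ∈ ℤ_{>0}`, the `B`-periodised samples
`f̃(n) = Σ_{l ∈ ℤ} f(n/A + lB)` are, up to the factor `B⁻¹`, the inverse DFT of length `N` of the
`A`-periodised samples of the spectrum `m ↦ Σ_{l ∈ ℤ} 𝓕 f((m + lN)/B)`:
`f̃(n) = B⁻¹ Σ_{m=0}^{N−1} e(mn/N) Σ_{l ∈ ℤ} 𝓕 f((m + lN)/B)`, `e(x) = e^{2πix}`.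
[cite: Platt2016GRH, Theorem 3.2 pp. 3011–3012 (= arXiv:1305.3087v1 Thm. 2.2)] -/
theorem _root_.Literature.NumberTheory.LFunctions.platt2016_poissonDFTPair (f : 𝓢(ℝ, ℂ)) {A B : ℝ}
    (hA : 0 < A) (hB : 0 < B) {N : ℕ} [NeZero N] (hN : A * B = N) (n : ℤ) :
    ∑' l : ℤ, f (n / A + l * B)
      = (B⁻¹ : ℂ) * ∑ m : Fin N, cexp (2 * π * I * ((m : ℤ) * n / N)) *
          ∑' l : ℤ, 𝓕 (f : ℝ → ℂ) (((m : ℤ) + l * N) / B) := by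
  rw [tsum_translate_eq f hB (n / A), tsum_int_eq_sum_tsum_mod _
    (summable_cexp_mul_fourier_div f hB (n / A)) N]
  congr 1
  refine Finset.sum_congr rfl fun m _ => ?_
  rw [← tsum_mul_left]
  refine tsum_congr fun q => ?_
  have hABN : (N : ℝ) = A * B := hN.symm
  have hexp : cexp (2 * π * I * (n / A : ℝ) * ((q * N + ((m : ℕ) : ℤ) : ℤ) : ℂ) / B)
      = cexp (2 * π * I * (((m : ℕ) : ℤ) * n / N)) := by
    have : (2 * π * I * (n / A : ℝ) * ((q * N + ((m : ℕ) : ℤ) : ℤ) : ℂ) / B : ℂ)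
        = 2 * π * I * (((m : ℕ) : ℤ) * n / N) + ((q * n : ℤ) : ℂ) * (2 * π * I) := by
      have hA' : (A : ℂ) ≠ 0 := by exact_mod_cast hA.ne'
      have hB' : (B : ℂ) ≠ 0 := by exact_mod_cast hB.ne'
      have hN' : (N : ℂ) = A * B := by exact_mod_cast hABN
      push_cast
      rw [hN']
      field_simp
      ring
    rw [this, Complex.exp_add, Complex.exp_int_mul_two_pi_mul_I, mul_one]
  rw [hexp]
  congr 2
  push_cast
  ring

end PoissonDFT

/-- **Platt 2016, Theorem 3.2 as printed** (journal p. 3011, proof p. 3012): with Platt's transform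
`f̂(x) = (1/2π) ∫ f(t) e^{−itx} dt`, `f̃(n) := Σ_{l ∈ ℤ} f(n/A + lB)` and
`\tilde{f̂}(m) := Σ_{l ∈ ℤ} f̂(2πm/B + 2πlA)`, "up to a constant factor, `f̃(n)` and `\tilde{f̂}(m)`
form a DFT pair of length `N`"; precisely (the last display of the proof)
`f̃(n) = (2π/B) Σ_{m=0}^{N−1} e(mn/N) \tilde{f̂}(m)` (an inverse DFT in the sense of
Definition 3.1).
Here `f` Schwartz, `A, B > 0`, `AB = N`. [cite: Platt2016GRH, Theorem 3.2 pp. 3011–3012] -/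
theorem platt2016_poissonDFTPair_printed (f : 𝓢(ℝ, ℂ)) {A B : ℝ} (hA : 0 < A) (hB : 0 < B)
    {N : ℕ} [NeZero N] (hN : A * B = N) (n : ℤ) :
    ∑' l : ℤ, f (n / A + l * B)
      = (2 * π / B : ℂ) * ∑ m : Fin N, cexp (2 * π * I * ((m : ℤ) * n / N)) *
          ∑' l : ℤ, (1 / (2 * π) : ℂ) *
            ∫ t : ℝ, f t * cexp (-(I * t * (2 * π * (m : ℤ) / B + 2 * π * l * A : ℝ))) := by
  rw [platt2016_poissonDFTPair f hA hB hN n]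
  have hA' : (A : ℂ) ≠ 0 := by exact_mod_cast hA.ne'
  have hB' : (B : ℂ) ≠ 0 := by exact_mod_cast hB.ne'
  have hπ : (π : ℂ) ≠ 0 := by exact_mod_cast Real.pi_ne_zero
  have hN' : (N : ℂ) = A * B := by exact_mod_cast hN.symm
  have hl : ∀ (m : Fin N) (l : ℤ),
      (1 / (2 * π) : ℂ) * ∫ t : ℝ, f t * cexp (-(I * t * (2 * π * (m : ℤ) / B + 2 * π * l * A : ℝ)))
        = (1 / (2 * π) : ℂ) * 𝓕 (f : ℝ → ℂ) (((m : ℤ) + l * N) / B) := by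
    intro m l
    rw [Upsampling.plattFourier_eq]
    congr 3
    rw [← hN]
    field_simp
  simp_rw [hl, tsum_mul_left, Finset.mul_sum]
  refine Finset.sum_congr rfl fun m _ => ?_
  have hc : ∀ e T : ℂ, (2 * π / B : ℂ) * (e * (1 / (2 * π) * T)) = (B⁻¹ : ℂ) * (e * T) := by
    intro e T
    field_simp
  rw [hc]
end Literature.NumberTheory.LFunctions
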